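import Summits.KontsevichZagierPeriods.KontsevichZagierPeriods.Theorems.TerasomaMultiplicationBetaCancellationStubTameFormAux3

/-!
# `BetaCancellation` (stmt-KontsevichZagierPeriods-13633), line `divisor-slicing-transshipment` — stub `stub_tameForm`, auxiliary file 10: vertical pieces

Piece data (in the format of `MIso`) for the two kinds of maps of `ℝᵐ⁺¹ = ℝᵐ × ℝ` that move only
the last coordinate, over a `ℚ`-semialgebraic base `G ⊆ ℝᵐ` (inside an open `U` carrying the regularity):

* `exists_verticalPiece` — `Ψ (y, s) = (y, H (y, s))` for `H` `ℚ`-semialgebraic and `C¹` on an open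
  `ℚ`-semialgebraic `U ⊆ G × ℝ`, strictly increasing in `s` on each fibre piece: `Ψ` is a
  `ℚ`-semialgebraic injective map on every `ℚ`-semialgebraic `P ⊆ U` with fibrewise-interval
  structure, with derivative of determinant `∂H/∂s` (`LinearMap.det_of_snoc_init`);
* `exists_affinePiece` — the special case `H (y, s) = α y + β y · s` (`α`, `β` `ℚ`-semialgebraic and
  `C¹` on `G`, `β > 0`), where moreover the image of the band `{a < s < b}` is the band
  `{α + β a < s < α + β b}` and the determinant is `β y`.

References: M. Kontsevich, D. Zagier, *Periods* (2001), §1.2 rule (2); pattern of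
`KZ.of_sub_of_mem_relations_of_affine`.
-/

noncomputable section

-- `Summit.KontsevichZagierPeriods.KontsevichZagierPeriods.…` is the tree's mandated layout (single-conjunct summit).
set_option linter.dupNamespace false

namespace Summit.KontsevichZagierPeriods.KontsevichZagierPeriods.BetaCancellationDivisorSlicing

open MeasureTheory Set Function Filter
open scoped Topology
open Literature.NumberTheory.Transcendental
open Literature.NumberTheory.Transcendental.KZ
open Literature.ModelTheory.ExponentialFields (IsSemialgebraic isSemialgebraic_univ)

variable {m : ℕ}

/-- The linear map `init : ℝᵐ⁺¹ → ℝᵐ` (as a continuous linear map). [folklore] -/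
theorem initCLM_apply (w : Fin (m + 1) → ℝ) :
    (ContinuousLinearMap.pi fun i : Fin m => ContinuousLinearMap.proj (R := ℝ)
      (φ := fun _ : Fin (m + 1) => ℝ) (Fin.castSucc i)) w = Fin.init w :=
  rfl

/-- **Vertical maps `(y, s) ↦ (y, H (y, s))`: derivative and determinant.** If `H : ℝᵐ⁺¹ → ℝ` has
the Fréchet derivative `H'` at `z`, then `Ψ w = (init w, H w)` has at `z` the derivative
`w ↦ (init w, H' w)`, of determinant `H' (0, …, 0, 1) = ∂H/∂s (z)`. [folklore] -/
theorem hasFDerivAt_vertical {H : (Fin (m + 1) → ℝ) → ℝ} {H' : (Fin (m + 1) → ℝ) →L[ℝ] ℝ}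
    {z : Fin (m + 1) → ℝ} (hH : HasFDerivAt H H' z) :
    ∃ L : (Fin (m + 1) → ℝ) →L[ℝ] (Fin (m + 1) → ℝ),
      HasFDerivAt (fun w : Fin (m + 1) → ℝ => (Fin.snoc (Fin.init w) (H w) : Fin (m + 1) → ℝ)) L z ∧
      (∀ w, L w = Fin.snoc (Fin.init w) (H' w)) ∧ L.det = H' (Pi.single (Fin.last m) 1) := by
  let initL : (Fin (m + 1) → ℝ) →L[ℝ] (Fin m → ℝ) :=
    ContinuousLinearMap.pi fun i : Fin m => ContinuousLinearMap.proj (R := ℝ)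
      (φ := fun _ : Fin (m + 1) => ℝ) (Fin.castSucc i)
  let L : (Fin (m + 1) → ℝ) →L[ℝ] (Fin (m + 1) → ℝ) :=
    ContinuousLinearMap.pi (Fin.lastCases (motive := fun _ => (Fin (m + 1) → ℝ) →L[ℝ] ℝ) H'
      (fun i => ContinuousLinearMap.proj (Fin.castSucc i)))
  have hL : ∀ w, L w = Fin.snoc (Fin.init w) (H' w) := by
    intro w
    funext i
    refine Fin.lastCases ?_ (fun j => ?_) i
    · simp [L]
    · simp [L, Fin.init]
  refine ⟨L, ?_, hL, ?_⟩
  · rw [hasFDerivAt_pi']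
    intro i
    refine Fin.lastCases ?_ (fun j => ?_) i
    · have hfun : (fun w : Fin (m + 1) → ℝ => (Fin.snoc (Fin.init w) (H w) : Fin (m + 1) → ℝ)
          (Fin.last m)) = H := by
        funext w
        simp
      rw [hfun]
      refine hH.congr_fderiv (ContinuousLinearMap.ext fun w => ?_)
      simp [hL]
    · have hfun : (fun w : Fin (m + 1) → ℝ => (Fin.snoc (Fin.init w) (H w) : Fin (m + 1) → ℝ)
          (Fin.castSucc j)) = fun w => w (Fin.castSucc j) := by
        funext w
        simp [Fin.init]
      rw [hfun]
      refine (hasFDerivAt_apply (Fin.castSucc j) z).congr_fderiv (ContinuousLinearMap.ext fun w => ?_)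
      simp [hL, Fin.init]
  · -- determinant: `L w = (init w, ℓ (init w) + c · w_last)` with `ℓ u = H' (u, 0)`, `c = H' e_last`
    have hsplit : ∀ w : Fin (m + 1) → ℝ,
        H' w = H' (Fin.snoc (Fin.init w) 0) + H' (Pi.single (Fin.last m) 1) * w (Fin.last m) := by
      intro w
      have hw : w = Fin.snoc (Fin.init w) 0 + w (Fin.last m) • (Pi.single (Fin.last m) (1 : ℝ)) := by
        funext i
        refine Fin.lastCases ?_ (fun j => ?_) i
        · simp
        · simp [Fin.init, (Fin.castSucc_lt_last j).ne]
      conv_lhs => rw [hw]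
      rw [map_add, map_smul, smul_eq_mul, mul_comm]
    let snoc0 : (Fin m → ℝ) →ₗ[ℝ] (Fin (m + 1) → ℝ) :=
      { toFun := fun u => Fin.snoc u 0
        map_add' := fun u v => by
          funext i; refine Fin.lastCases ?_ (fun j => ?_) i <;> simp
        map_smul' := fun c u => by
          funext i; refine Fin.lastCases ?_ (fun j => ?_) i <;> simp }
    have h := LinearMap.det_of_snoc_init (L : (Fin (m + 1) → ℝ) →ₗ[ℝ] (Fin (m + 1) → ℝ))
      LinearMap.id ((H' : (Fin (m + 1) → ℝ) →ₗ[ℝ] ℝ).comp snoc0) (H' (Pi.single (Fin.last m) 1))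
      (fun w => by
        rw [ContinuousLinearMap.coe_coe, hL]
        simp only [LinearMap.id_coe, id_eq, LinearMap.coe_comp, Function.comp_apply,
          ContinuousLinearMap.coe_coe]
        congr 1
        exact hsplit w)
    rw [LinearMap.det_id, mul_one] at h
    exact h

/-- **Vertical pieces.** Let `U ⊆ ℝᵐ⁺¹` be open and `H` a function with Fréchet derivative
`H' z` at every `z ∈ U`. On a `ℚ`-semialgebraic `P ⊆ U` on which `H` is `ℚ`-semialgebraic and
fibrewise injective (`H (y, s) = H (y, s') ⇒ s = s'` for `(y, s), (y, s') ∈ P`), the vertical map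
`Ψ (y, s) = (y, H (y, s))` is a `ℚ`-semialgebraic injective map with derivative within `P` of
determinant `∂H/∂s`. [folklore] -/
theorem exists_verticalPiece {U P : Set (Fin (m + 1) → ℝ)} (_hU : IsOpen U) (hPU : P ⊆ U)
    (hP : IsSemialgebraic ℚ P) {H : (Fin (m + 1) → ℝ) → ℝ}
    {H' : (Fin (m + 1) → ℝ) → ((Fin (m + 1) → ℝ) →L[ℝ] ℝ)} (hH : IsSemialgebraicFunOn ℚ P H)
    (hH' : ∀ z ∈ U, HasFDerivAt H (H' z) z)
    (hinj : ∀ z ∈ P, ∀ z' ∈ P, Fin.init z = Fin.init z' → H z = H z' → z = z') :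
    ∃ Ψ' : (Fin (m + 1) → ℝ) → ((Fin (m + 1) → ℝ) →L[ℝ] (Fin (m + 1) → ℝ)),
      IsSemialgebraicMapOn ℚ P (fun w => Fin.snoc (Fin.init w) (H w)) ∧
      InjOn (fun w : Fin (m + 1) → ℝ => (Fin.snoc (Fin.init w) (H w) : Fin (m + 1) → ℝ)) P ∧
      (∀ z ∈ P, HasFDerivWithinAt (fun w : Fin (m + 1) → ℝ =>
        (Fin.snoc (Fin.init w) (H w) : Fin (m + 1) → ℝ)) (Ψ' z) P z) ∧
      (∀ z ∈ P, (Ψ' z).det = H' z (Pi.single (Fin.last m) 1)) := by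
  choose L hL hLw hLdet using fun z (hz : z ∈ P) => hasFDerivAt_vertical (hH' z (hPU hz))
  classical
  refine ⟨fun z => if hz : z ∈ P then L z hz else 0, ?_, ?_, fun z hz => ?_, fun z hz => ?_⟩
  · refine (isSemialgebraicMapOn_iff_forall_holds hP).mpr fun i => ?_
    refine Fin.lastCases ?_ (fun j => ?_) i
    · exact hH.congr fun z _ => by simp
    · exact (isSemialgebraicFunOn_aeval hP (MvPolynomial.X (Fin.castSucc j))).congr fun z _ => by
        simp [Fin.init]
  · intro z hz z' hz' h
    have hi : Fin.init z = Fin.init z' := by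
      have := congrArg Fin.init h
      simpa using this
    have hl : H z = H z' := by
      have := congrFun h (Fin.last m)
      simpa using this
    exact hinj z hz z' hz' hi hl
  · simp only [dif_pos hz]
    exact (hL z hz).hasFDerivWithinAt
  · simp only [dif_pos hz]
    exact hLdet z hz

/-- **Affine vertical pieces.** Over a `ℚ`-semialgebraic `G ⊆ ℝᵐ` let `α`, `β` be `ℚ`-semialgebraic,
differentiable on an open `U ⊇ G`, `β > 0` on `G`, and `a`, `b` `ℚ`-semialgebraic. On the band
`P = {(y, s) | y ∈ G, a y < s < b y}` the map `Ψ (y, s) = (y, α y + β y · s)` is a `ℚ`-semialgebraic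
injective map with derivative within `P` of determinant `β y`, and
`Ψ P = {(y, s) | y ∈ G, α y + β y · a y < s < α y + β y · b y}`.
[cite: KontsevichZagier2001, §1.2 rule (2)] -/
theorem exists_affinePiece {G U : Set (Fin m → ℝ)} (hUo : IsOpen U) (hGU : G ⊆ U)
    (hG : IsSemialgebraic ℚ G) {α β a b : (Fin m → ℝ) → ℝ} (hα : IsSemialgebraicFunOn ℚ G α)
    (hβ : IsSemialgebraicFunOn ℚ G β) (hαd : DifferentiableOn ℝ α U) (hβd : DifferentiableOn ℝ β U)
    (hβpos : ∀ y ∈ G, 0 < β y) (ha : IsSemialgebraicFunOn ℚ G a) (hb : IsSemialgebraicFunOn ℚ G b) :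
    ∃ Ψ' : (Fin (m + 1) → ℝ) → ((Fin (m + 1) → ℝ) →L[ℝ] (Fin (m + 1) → ℝ)),
      IsSemialgebraic ℚ {z : Fin (m + 1) → ℝ | (Fin.init z : Fin m → ℝ) ∈ G ∧ a (Fin.init z) < z (Fin.last m) ∧
        z (Fin.last m) < b (Fin.init z)} ∧
      IsSemialgebraicMapOn ℚ {z : Fin (m + 1) → ℝ | (Fin.init z : Fin m → ℝ) ∈ G ∧ a (Fin.init z) < z (Fin.last m) ∧
        z (Fin.last m) < b (Fin.init z)}
        (fun w => Fin.snoc (Fin.init w) (α (Fin.init w) + β (Fin.init w) * w (Fin.last m))) ∧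
      InjOn (fun w : Fin (m + 1) → ℝ => (Fin.snoc (Fin.init w)
        (α (Fin.init w) + β (Fin.init w) * w (Fin.last m)) : Fin (m + 1) → ℝ))
        {z : Fin (m + 1) → ℝ | (Fin.init z : Fin m → ℝ) ∈ G ∧ a (Fin.init z) < z (Fin.last m) ∧ z (Fin.last m) < b (Fin.init z)} ∧
      (∀ z ∈ {z : Fin (m + 1) → ℝ | (Fin.init z : Fin m → ℝ) ∈ G ∧ a (Fin.init z) < z (Fin.last m) ∧
          z (Fin.last m) < b (Fin.init z)},
        HasFDerivWithinAt (fun w : Fin (m + 1) → ℝ => (Fin.snoc (Fin.init w)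
          (α (Fin.init w) + β (Fin.init w) * w (Fin.last m)) : Fin (m + 1) → ℝ)) (Ψ' z)
          {z : Fin (m + 1) → ℝ | (Fin.init z : Fin m → ℝ) ∈ G ∧ a (Fin.init z) < z (Fin.last m) ∧ z (Fin.last m) < b (Fin.init z)} z) ∧
      (∀ z ∈ {z : Fin (m + 1) → ℝ | (Fin.init z : Fin m → ℝ) ∈ G ∧ a (Fin.init z) < z (Fin.last m) ∧
          z (Fin.last m) < b (Fin.init z)}, (Ψ' z).det = β (Fin.init z)) ∧
      (fun w : Fin (m + 1) → ℝ => (Fin.snoc (Fin.init w)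
        (α (Fin.init w) + β (Fin.init w) * w (Fin.last m)) : Fin (m + 1) → ℝ)) ''
        {z : Fin (m + 1) → ℝ | (Fin.init z : Fin m → ℝ) ∈ G ∧ a (Fin.init z) < z (Fin.last m) ∧ z (Fin.last m) < b (Fin.init z)} =
        {z : Fin (m + 1) → ℝ | (Fin.init z : Fin m → ℝ) ∈ G ∧ α (Fin.init z) + β (Fin.init z) * a (Fin.init z) < z (Fin.last m) ∧
          z (Fin.last m) < α (Fin.init z) + β (Fin.init z) * b (Fin.init z)} := by
  set P := {z : Fin (m + 1) → ℝ | (Fin.init z : Fin m → ℝ) ∈ G ∧ a (Fin.init z) < z (Fin.last m) ∧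
    z (Fin.last m) < b (Fin.init z)} with hP_def
  set C := {z : Fin (m + 1) → ℝ | (Fin.init z : Fin m → ℝ) ∈ G} with hC_def
  set U' := {z : Fin (m + 1) → ℝ | (Fin.init z : Fin m → ℝ) ∈ U} with hU'_def
  have hU'o : IsOpen U' := hUo.preimage continuous_id.finInit
  have hPC : P ⊆ C := fun z hz => hz.1
  have hPU : P ⊆ U' := fun z hz => hGU hz.1
  -- semialgebraicity of the band
  have hcyl : IsSemialgebraic ℚ C := hG.preimage_comp Fin.castSucc
  have hai : IsSemialgebraicFunOn ℚ C (fun z => a (Fin.init z)) := ha.comp_init_mono hcyl fun _ h => h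
  have hbi : IsSemialgebraicFunOn ℚ C (fun z => b (Fin.init z)) := hb.comp_init_mono hcyl fun _ h => h
  have hli : IsSemialgebraicFunOn ℚ C (fun z => z (Fin.last m)) := isSemialgebraicFunOn_apply hcyl _
  have hP : IsSemialgebraic ℚ P := by
    have h1 := isSemialgebraic_sep_lt' hai hli
    have h2 := isSemialgebraic_sep_lt' hli hbi
    convert h1.inter h2 using 1
    ext z
    simp only [hP_def, hC_def, mem_setOf_eq, mem_inter_iff]
    tauto
  -- the map as a vertical map
  set H : (Fin (m + 1) → ℝ) → ℝ := fun w => α (Fin.init w) + β (Fin.init w) * w (Fin.last m) with hH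
  have hαd' : ∀ y ∈ U, HasFDerivAt α (fderiv ℝ α y) y := fun y hy =>
    ((hαd y hy).differentiableAt (hUo.mem_nhds hy)).hasFDerivAt
  have hβd' : ∀ y ∈ U, HasFDerivAt β (fderiv ℝ β y) y := fun y hy =>
    ((hβd y hy).differentiableAt (hUo.mem_nhds hy)).hasFDerivAt
  let initL : (Fin (m + 1) → ℝ) →L[ℝ] (Fin m → ℝ) :=
    ContinuousLinearMap.pi fun i : Fin m => ContinuousLinearMap.proj (R := ℝ)
      (φ := fun _ : Fin (m + 1) => ℝ) (Fin.castSucc i)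
  let lastL : (Fin (m + 1) → ℝ) →L[ℝ] ℝ := ContinuousLinearMap.proj (Fin.last m)
  let H' : (Fin (m + 1) → ℝ) → (Fin (m + 1) → ℝ) →L[ℝ] ℝ := fun z =>
    (fderiv ℝ α (Fin.init z)).comp initL +
      (z (Fin.last m) • (fderiv ℝ β (Fin.init z)).comp initL + β (Fin.init z) • lastL)
  have hH' : ∀ z ∈ U', HasFDerivAt H (H' z) z := by
    intro z hz
    have h1 : HasFDerivAt (fun x : Fin (m + 1) → ℝ => Fin.init x) initL z := initL.hasFDerivAt
    have hαc := (hαd' _ hz).comp z h1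
    have hβc := (hβd' _ hz).comp z h1
    have hl : HasFDerivAt (fun x : Fin (m + 1) → ℝ => x (Fin.last m)) lastL z :=
      hasFDerivAt_apply (Fin.last m) z
    have h := hαc.add (hβc.mul hl)
    refine h.congr_fderiv (ContinuousLinearMap.ext fun w => ?_)
    simp [H', lastL, initL, initCLM_apply]
    ring
  have hHsa : IsSemialgebraicFunOn ℚ P H := by
    have hαi : IsSemialgebraicFunOn ℚ C (fun z => α (Fin.init z)) := hα.comp_init_mono hcyl fun _ h => h
    have hβi : IsSemialgebraicFunOn ℚ C (fun z => β (Fin.init z)) := hβ.comp_init_mono hcyl fun _ h => h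
    exact (IsSemialgebraicFunOn.add_holds hαi (IsSemialgebraicFunOn.mul_holds hβi hli)).mono hPC hP
  have hHinj : ∀ z ∈ P, ∀ z' ∈ P, Fin.init z = Fin.init z' → H z = H z' → z = z' := by
    intro z hz z' hz' hi hl
    simp only [hH, hi] at hl
    have hs : z (Fin.last m) = z' (Fin.last m) :=
      mul_left_cancel₀ (hβpos _ hz'.1).ne' (add_left_cancel hl)
    rw [← Fin.snoc_init_self z, ← Fin.snoc_init_self z', hi, hs]
  obtain ⟨Ψ', hsa, hinjP, hderP, hdetP⟩ := exists_verticalPiece hU'o hPU hP hHsa hH' hHinj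
  refine ⟨Ψ', hP, hsa, hinjP, hderP, fun z hz => ?_, ?_⟩
  · rw [hdetP z hz]
    have h0 : (Fin.init (Pi.single (Fin.last m) (1 : ℝ) : Fin (m + 1) → ℝ) : Fin m → ℝ) = 0 := by
      funext j
      simp [Fin.init, (Fin.castSucc_lt_last j).ne]
    simp [H', lastL, initL, initCLM_apply, h0]
  · ext w
    simp only [mem_image, mem_setOf_eq, hP_def]
    constructor
    · rintro ⟨z, ⟨hz, hza, hzb⟩, rfl⟩
      have hβz := hβpos _ hz
      refine ⟨by simpa using hz, ?_, ?_⟩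
      · simp only [Fin.init_snoc, Fin.snoc_last]
        nlinarith
      · simp only [Fin.init_snoc, Fin.snoc_last]
        nlinarith
    · rintro ⟨hw, hwa, hwb⟩
      have hβw := hβpos _ hw
      refine ⟨Fin.snoc (Fin.init w) ((w (Fin.last m) - α (Fin.init w)) / β (Fin.init w)),
        ⟨by simpa using hw, ?_, ?_⟩, ?_⟩
      · simp only [Fin.init_snoc, Fin.snoc_last]
        rw [lt_div_iff₀ hβw]
        linarith
      · simp only [Fin.init_snoc, Fin.snoc_last]
        rw [div_lt_iff₀ hβw]
        linarith
      · simp only [Fin.init_snoc, Fin.snoc_last]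
        rw [mul_div_cancel₀ _ hβw.ne', add_sub_cancel, Fin.snoc_init_self]

/-! ### Headline -/

/-- Registered helper goal of the stub `stub_tameForm`: vertical maps `(y, s) ↦ (y, H (y, s))` have
derivative of determinant `∂H/∂s`. [folklore] -/
theorem tameForm_aux_verticalDet : ∀ {m : ℕ} {H : (Fin (m + 1) → ℝ) → ℝ} {H' : (Fin (m + 1) → ℝ) →L[ℝ] ℝ} {z : Fin (m + 1) → ℝ}, HasFDerivAt H H' z → ∃ L : (Fin (m + 1) → ℝ) →L[ℝ] (Fin (m + 1) → ℝ), HasFDerivAt (fun w : Fin (m + 1) → ℝ => (Fin.snoc (Fin.init w) (H w) : Fin (m + 1) → ℝ)) L z ∧ (∀ w, L w = Fin.snoc (Fin.init w) (H' w)) ∧ L.det = H' (Pi.single (Fin.last m) 1) :=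
  fun hH => hasFDerivAt_vertical hH

end Summit.KontsevichZagierPeriods.KontsevichZagierPeriods.BetaCancellationDivisorSlicing

end
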